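import Mathlib.RepresentationTheory.Semisimple
import Mathlib.RingTheory.SimpleModule.Basic
import Mathlib.RingTheory.Localization.BaseChange
import Mathlib.RingTheory.Flat.Basic
import Mathlib.LinearAlgebra.Projection
import Mathlib.LinearAlgebra.Prod
import Literature.AlgebraicGeometry.Motives.FaltingsECSubspaces
import Literature.NumberTheory.EllipticCurves.TateModuleFreeProofs
import HarnessLib

/-!
# Faltings 1983, §5: Sätze 3–4 for `E` imply the subspace statement for `E × E`

Family Hodge (group G16); notions `tate_module`, `cm_endomorphisms_isogeny`. A sibling *proofs*
file (theorems only) of `Literature.AlgebraicGeometry.Motives.FaltingsECSubspaces`, which vendors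
the named fact `Literature.Hodge.stable_subspace_prod_eq_range W ℓ` — every `Γ_K`-stable `ℚ_ℓ`-subspace
of `V_ℓ E × V_ℓ E` is the image of an endomorphism `(a b; c d)` with entries in
`E_ℓ = image(End_K(E) ⊗ ℚ_ℓ → End(V_ℓ E))` (Faltings, Invent. Math. 73 (1983), §5, the step
"`W` is the image of an idempotent in `End_K(A) ⊗_ℤ ℚ_ℓ`" of the proof of Sätze 3–4, for
`A = E × E`) — and derives from it Satz 4 for `E` (`mem_span_range_tateEndRingHom_iff_of_facts`).
The docstring of that file asserts that, conversely, the subspace statement *follows* from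
Sätze 3–4 for `E` over `K` itself ("Satz 3 gives a `Γ_K`-equivariant projector onto the subspace,
Satz 4 … places it in `M₂(End_K(E) ⊗ ℚ_ℓ)`"), so that the vendored fact is a reformulation of
Sätze 3–4 for `E` and not a stronger assertion. This file **proves** that converse:

* `Literature.AlgebraicGeometry.Motives.stable_subspace_prod_eq_range_of_faltings`:
  `isSemisimpleRepresentation_rationalGaloisRepTate W ℓ` (Satz 3 for `E`) and
  `mem_span_range_tateEndRingHom_iff W ℓ` (Satz 4 for `E`) imply
  `stable_subspace_prod_eq_range W ℓ`.

The proof is the one indicated: `V_ℓ E × V_ℓ E` is a semisimple `ℚ_ℓ[Γ_K]`-module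
(`Literature.AlgebraicGeometry.Motives.isSemisimpleRepresentation_prod`, through Mathlib's
`Representation.isSemisimpleRepresentation_iff_isSemisimpleModule_asModule`), so a stable
subspace `U` has a stable complement and the projector `P` onto `U` along it is `Γ_K`-equivariant
(`Literature.AlgebraicGeometry.Motives.exists_equivariant_range_eq`); its four matrix entries are `Γ_K`-equivariant endomorphisms
of `V_ℓ E`, and these lie in `E_ℓ` by Satz 4 (`mem_rationalEndSpan_of_equivariant`: the
`ℚ_ℓ`-form `End_{Γ_K}(V_ℓ E) = E_ℓ` of the `ℤ_ℓ`-statement `ℤ_ℓ · End_K(E) = End_{Γ_K}(T_ℓ E)`,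
by clearing denominators in `End(V_ℓ E) = ℚ_ℓ ⊗ End(T_ℓ E)`, `T_ℓ E` being finite free over
`ℤ_ℓ` by the tree's `module_free_tateModule_holds` / `module_finite_tateModule_holds`).

## Contents (all proved; no definitions)

* `Literature.AlgebraicGeometry.Motives.isSemisimpleModule_prod`, `Literature.AlgebraicGeometry.Motives.nonempty_prodAsModuleLinearEquiv`,
  `Literature.AlgebraicGeometry.Motives.isSemisimpleRepresentation_prod`: products of semisimple modules / representations are
  semisimple (Mathlib has the `Π`- and `→₀`-instances, not the binary product).
* `Literature.AlgebraicGeometry.Motives.exists_equivariant_range_eq`: in a semisimple representation every stable subspace is the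
  image of an equivariant projector (Mathlib `Submodule.projection`).
* `Literature.AlgebraicGeometry.Motives.exists_smul_eq_baseChange`: for `M` finite free over `ℤ_ℓ` and `G ∈ End_{ℚ_ℓ}(ℚ_ℓ ⊗ M)`
  there are `b ∈ ℤ_ℓ ∖ {0}` and `g ∈ End(M)` with `b G = 1 ⊗ g`.
* `Literature.AlgebraicGeometry.Motives.baseChange_mem_rationalEndSpan`, `Literature.AlgebraicGeometry.Motives.mem_rationalEndSpan_of_equivariant`,
  `Literature.AlgebraicGeometry.Motives.mem_rationalEndSpan_iff`: granted Satz 4 for `E`, `E_ℓ = End_{Γ_K}(V_ℓ E)`.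
* `Literature.AlgebraicGeometry.Motives.stable_subspace_prod_eq_range_of_faltings`: the target.

## References

* [Faltings1983Endlichkeit] G. Faltings, *Endlichkeitssätze für abelsche Varietäten über
  Zahlkörpern*, Invent. Math. 73 (1983), 349–366, §5, Satz 3, Satz 4, Korollar 1 and the proof of
  Sätze 3–4; Engl. transl. in Cornell–Silverman (eds.), *Arithmetic Geometry*, Springer 1986,
  Ch. II, §5, Theorems 3–4 (pp. 17–18 of the chapter).
* [Tate1966Endomorphisms] J. Tate, *Endomorphisms of abelian varieties over finite fields*,
  Invent. Math. 2 (1966), 134–144, §1, Lemma 1 ff. (the passage between `T_ℓ` and `V_ℓ`).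

## Design

`noncomputable section`; general lemmas in `namespace Literature`, the elliptic-curve statements in
`namespace Literature.Hodge` with the conventions of `FaltingsECSubspaces` (`K : Type u`, hypothesis
instances `[NumberField K] [W.IsElliptic]` introduced where the named facts quantify them). No
statement of the tree is modified; the file only adds theorems.
-/

noncomputable section

open scoped TensorProduct

universe u

/-! ## Semisimplicity of a product of semisimple representations -/

namespace Literature.AlgebraicGeometry.Motives

section Semisimple

variable {R M N : Type*} [Ring R] [AddCommGroup M] [Module R M] [AddCommGroup N] [Module R N]

/-- **The product of two semisimple modules is semisimple**: the ranges of the two inclusions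
`M → M × N ← N` are semisimple (isomorphic to `M`, `N`) and their supremum is everything
(Mathlib `IsSemisimpleModule.sup`, `LinearMap.sup_range_inl_inr`). Mathlib records the instances
for `Π i, M i` (finite index type) and `ι →₀ M`, not for the binary product. [folklore] -/
theorem isSemisimpleModule_prod [IsSemisimpleModule R M] [IsSemisimpleModule R N] :
    IsSemisimpleModule R (M × N) := by
  have h1 : IsSemisimpleModule R (LinearMap.range (LinearMap.inl R M N)) :=
    .congr (LinearEquiv.ofInjective _ LinearMap.inl_injective).symm
  have h2 : IsSemisimpleModule R (LinearMap.range (LinearMap.inr R M N)) :=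
    .congr (LinearEquiv.ofInjective _ LinearMap.inr_injective).symm
  have h := h1.sup h2
  rw [LinearMap.sup_range_inl_inr] at h
  exact .congr Submodule.topEquiv.symm

end Semisimple

section Rep

variable {k G V V' : Type*} [Field k] [Monoid G] [AddCommGroup V] [Module k V]
  [AddCommGroup V'] [Module k V']

open Representation in
/-- The `k[G]`-module of the product representation `ρ × ρ'` is `k[G]`-linearly isomorphic to
the product of the `k[G]`-modules of `ρ` and `ρ'` (by the identity map; `k[G]`-linearity is
checked on group elements, sums and scalars). [folklore] -/
theorem nonempty_prodAsModuleLinearEquiv (ρ : Representation k G V) (ρ' : Representation k G V') :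
    Nonempty ((ρ.prod ρ').asModule ≃ₗ[MonoidAlgebra k G] (ρ.asModule × ρ'.asModule)) := by
  refine ⟨{ toFun := fun x ↦ (ρ.asModuleEquiv.symm ((ρ.prod ρ').asModuleEquiv x).1,
              ρ'.asModuleEquiv.symm ((ρ.prod ρ').asModuleEquiv x).2)
            invFun := fun y ↦ (ρ.prod ρ').asModuleEquiv.symm
              (ρ.asModuleEquiv y.1, ρ'.asModuleEquiv y.2)
            left_inv := fun x ↦ by simp
            right_inv := fun y ↦ by simp
            map_add' := fun x y ↦ by simp
            map_smul' := fun r x ↦ ?_ }⟩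
  induction r using MonoidAlgebra.induction_on with
  | hM g =>
    refine Prod.ext ?_ ?_
    · simp only [RingHom.id_apply, Prod.smul_fst]
      rw [asModuleEquiv_map_smul, asAlgebraHom_of, ← asModuleEquiv_symm_map_rho]
      rfl
    · simp only [RingHom.id_apply, Prod.smul_snd]
      rw [asModuleEquiv_map_smul, asAlgebraHom_of, ← asModuleEquiv_symm_map_rho]
      rfl
  | hadd f g hf hg =>
    simp only [RingHom.id_apply] at hf hg ⊢
    rw [add_smul, add_smul, ← hf, ← hg]
    simp
  | hsmul c f hf =>
    simp only [RingHom.id_apply] at hf ⊢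
    rw [smul_assoc, smul_assoc, ← hf]
    refine Prod.ext ?_ ?_
    · simp only [Prod.smul_fst, map_smul]
    · simp only [Prod.smul_snd, map_smul]

/-- **The product of two semisimple representations is semisimple** (over a field `k`, for a
monoid `G`): through Mathlib's dictionary
`Representation.isSemisimpleRepresentation_iff_isSemisimpleModule_asModule` this is
`Literature.AlgebraicGeometry.Motives.isSemisimpleModule_prod` for `k[G]`-modules. [folklore] -/
theorem isSemisimpleRepresentation_prod {ρ : Representation k G V} {ρ' : Representation k G V'}
    (h : ρ.IsSemisimpleRepresentation) (h' : ρ'.IsSemisimpleRepresentation) :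
    (ρ.prod ρ').IsSemisimpleRepresentation := by
  rw [Representation.isSemisimpleRepresentation_iff_isSemisimpleModule_asModule] at h h' ⊢
  haveI := h
  haveI := h'
  haveI : IsSemisimpleModule (MonoidAlgebra k G) (ρ.asModule × ρ'.asModule) :=
    isSemisimpleModule_prod
  obtain ⟨e⟩ := nonempty_prodAsModuleLinearEquiv ρ ρ'
  exact .congr e

/-- **In a semisimple representation every stable subspace is the image of an equivariant
projector**: a stable subspace `U` (a `Subrepresentation`) has a stable complement `Q`
(`ComplementedLattice`), and the projection onto `U` along `Q` (Mathlib `Submodule.projection`)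
commutes with the action, since both `U` and `Q` are stable. This is the use of Satz 3
(semisimplicity) in Faltings' and Tate's arguments. [folklore] -/
theorem exists_equivariant_range_eq {ρ : Representation k G V} (h : ρ.IsSemisimpleRepresentation)
    (U : Submodule k V) (hU : ∀ (g : G) (v : V), v ∈ U → ρ g v ∈ U) :
    ∃ P : Module.End k V, (∀ (g : G) (v : V), P (ρ g v) = ρ g (P v)) ∧ LinearMap.range P = U := by
  let U' : Subrepresentation ρ := ⟨U, fun g v hv ↦ hU g v hv⟩
  haveI := h
  obtain ⟨Q', hQ'⟩ := exists_isCompl U'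
  have hc : IsCompl U Q'.toSubmodule := by
    constructor
    · rw [disjoint_iff, ← show U'.toSubmodule = U from rfl, ← Subrepresentation.toSubmodule_inf,
        hQ'.inf_eq_bot]
      rfl
    · rw [codisjoint_iff, ← show U'.toSubmodule = U from rfl, ← Subrepresentation.toSubmodule_sup,
        hQ'.sup_eq_top]
      rfl
  refine ⟨U.projection Q'.toSubmodule hc, fun g v ↦ ?_, Submodule.range_projection hc⟩
  have hv := Submodule.projection_add_projection_eq_self hc v
  conv_lhs => rw [← hv]
  rw [map_add, map_add,
    Submodule.projection_apply_of_mem_left hc (hU g _ (Submodule.projection_apply_mem hc v)),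
    Submodule.projection_apply_of_mem_right hc
      (Q'.apply_mem_toSubmodule g (Submodule.projection_apply_mem hc.symm v)), add_zero]

end Rep

/-! ## Clearing denominators in `End(ℚ_ℓ ⊗ M)` for `M` finite free over `ℤ_ℓ` -/

section ClearDenominators

variable (ℓ : ℕ) [Fact ℓ.Prime] {M : Type*} [AddCommGroup M] [Module ℤ_[ℓ] M]

/-- For a finite free `ℤ_ℓ`-module `M`, every `ℚ_ℓ`-linear endomorphism `G` of `ℚ_ℓ ⊗ M` has a
non-zero multiple `b G`, `b ∈ ℤ_ℓ`, which is the base change of an endomorphism of `M`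
(`End(ℚ_ℓ ⊗ M) = ℚ_ℓ ⊗ End(M)`: clear the denominators of the images of a basis). [folklore] -/
theorem exists_smul_eq_baseChange [Module.Free ℤ_[ℓ] M] [Module.Finite ℤ_[ℓ] M]
    (G : Module.End ℚ_[ℓ] (ℚ_[ℓ] ⊗[ℤ_[ℓ]] M)) :
    ∃ b : ℤ_[ℓ], b ≠ 0 ∧ ∃ g : Module.End ℤ_[ℓ] M, (b : ℚ_[ℓ]) • G = g.baseChange ℚ_[ℓ] := by
  classical
  let bs := Module.finBasis ℤ_[ℓ] M
  have hsurj := fun i ↦ IsLocalizedModule.surj (nonZeroDivisors ℤ_[ℓ])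
    (TensorProduct.mk ℤ_[ℓ] ℚ_[ℓ] M 1) (G (1 ⊗ₜ bs i))
  choose y hy using hsurj
  set s : Fin (Module.finrank ℤ_[ℓ] M) → ℤ_[ℓ] := fun i ↦ ((y i).2 : ℤ_[ℓ]) with hs
  have hs0 : ∀ i, s i ≠ 0 := fun i ↦ nonZeroDivisors.coe_ne_zero _
  set b' : Fin (Module.finrank ℤ_[ℓ] M) → ℤ_[ℓ] := fun i ↦ ∏ j ∈ Finset.univ.erase i, s j
    with hb'
  refine ⟨∏ i, s i, Finset.prod_ne_zero_iff.mpr fun i _ ↦ hs0 i,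
    bs.constr ℤ_[ℓ] fun i ↦ b' i • (y i).1, ?_⟩
  have hbb : ∀ i, ∏ j, s j = b' i * s i := fun i ↦
    (Finset.prod_erase_mul Finset.univ s (Finset.mem_univ i)).symm
  -- reduce to the generators `1 ⊗ bs i`
  have key : ∀ m : M, ((∏ i, s i : ℤ_[ℓ]) : ℚ_[ℓ]) • G (1 ⊗ₜ m) =
      (1 : ℚ_[ℓ]) ⊗ₜ[ℤ_[ℓ]] (bs.constr ℤ_[ℓ] (fun i ↦ b' i • (y i).1) m) := by
    intro m
    suffices h : (((∏ i, s i : ℤ_[ℓ]) : ℚ_[ℓ]) • G).restrictScalars ℤ_[ℓ] ∘ₗ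
        TensorProduct.mk ℤ_[ℓ] ℚ_[ℓ] M 1 =
        TensorProduct.mk ℤ_[ℓ] ℚ_[ℓ] M 1 ∘ₗ bs.constr ℤ_[ℓ] (fun i ↦ b' i • (y i).1) from
      LinearMap.congr_fun h m
    refine bs.ext fun i ↦ ?_
    simp only [LinearMap.coe_comp, Function.comp_apply, TensorProduct.mk_apply,
      LinearMap.coe_restrictScalars, LinearMap.smul_apply, Module.Basis.constr_basis]
    have hyi : ((s i : ℤ_[ℓ]) : ℚ_[ℓ]) • G (1 ⊗ₜ bs i) = (1 : ℚ_[ℓ]) ⊗ₜ[ℤ_[ℓ]] (y i).1 := by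
      have h := hy i
      rw [Submonoid.smul_def, TensorProduct.mk_apply] at h
      rw [← h]
      exact algebraMap_smul ℚ_[ℓ] (s i) _
    rw [hbb i, PadicInt.coe_mul, mul_smul, hyi, TensorProduct.tmul_smul]
    exact algebraMap_smul ℚ_[ℓ] (b' i) _
  refine TensorProduct.AlgebraTensorModule.ext fun q m ↦ ?_
  rw [LinearMap.baseChange_tmul, LinearMap.smul_apply]
  have hq : q ⊗ₜ[ℤ_[ℓ]] m = q • ((1 : ℚ_[ℓ]) ⊗ₜ[ℤ_[ℓ]] m) := by
    rw [TensorProduct.smul_tmul', smul_eq_mul, mul_one]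
  rw [hq, map_smul, smul_comm, key m, TensorProduct.smul_tmul', smul_eq_mul, mul_one]

end ClearDenominators

end Literature.AlgebraicGeometry.Motives

namespace Literature.AlgebraicGeometry.Motives

open WeierstrassCurve

variable {K : Type u} [Field K] (W : WeierstrassCurve K) (ℓ : ℕ) [Fact ℓ.Prime]

/-! ## `End_{Γ_K}(V_ℓ E) ⊆ E_ℓ` from Satz 4 -/

/-- Base change `End(T_ℓ E) → End(V_ℓ E)`, `g ↦ 1 ⊗ g`, carries `ℤ_ℓ · End_K(E)` into
`E_ℓ = ℚ_ℓ · (1 ⊗ End_K(E))` (it is additive and `ℤ_ℓ`-linear). [folklore] -/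
theorem baseChange_mem_rationalEndSpan {g : Module.End ℤ_[ℓ] (W.tateModule ℓ)}
    (hg : g ∈ Submodule.span ℤ_[ℓ] (Set.range (tateEndRingHom W ℓ))) :
    (g.baseChange ℚ_[ℓ] : Module.End ℚ_[ℓ] (W.rationalTateModule ℓ)) ∈ rationalEndSpan W ℓ := by
  induction hg using Submodule.span_induction with
  | mem f hf =>
    obtain ⟨φ, rfl⟩ := hf
    exact baseChange_tateEndRingHom_mem_rationalEndSpan W ℓ φ
  | zero =>
    rw [LinearMap.baseChange_zero]
    exact (rationalEndSpan W ℓ).zero_mem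
  | add f f' _ _ hf hf' =>
    rw [LinearMap.baseChange_add]
    exact (rationalEndSpan W ℓ).add_mem hf hf'
  | smul c f _ hf =>
    rw [LinearMap.baseChange_smul]
    exact (rationalEndSpan W ℓ).smul_of_tower_mem c hf

/-- **The `ℚ_ℓ`-form of Satz 4 from its `ℤ_ℓ`-form.** Granted the named fact
`mem_span_range_tateEndRingHom_iff W ℓ` (Faltings 1983, Satz 4 for `E`:
`ℤ_ℓ · End_K(E) = End_{Γ_K}(T_ℓ E)`), every `Γ_K`-equivariant `ℚ_ℓ`-linear endomorphism `G` of
`V_ℓ E` lies in `E_ℓ = image(End_K(E) ⊗ ℚ_ℓ)`: `T_ℓ E` is finite free over `ℤ_ℓ`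
(`module_free_tateModule_holds`, `module_finite_tateModule_holds`), so `b G = 1 ⊗ g` for some
`b ≠ 0` and `g ∈ End(T_ℓ E)` (`Literature.AlgebraicGeometry.Motives.exists_smul_eq_baseChange`); `g` is equivariant because base
change `End(T_ℓ E) → End(V_ℓ E)` is injective (`T_ℓ E` is flat), so `g ∈ ℤ_ℓ · End_K(E)` and
`G = b⁻¹ (1 ⊗ g) ∈ E_ℓ`. Faltings, §5: "it suffices to show that `End_K(A) ⊗ ℚ_ℓ → End_π(T_ℓ ⊗ ℚ_ℓ)`
is bijective" (the converse bookkeeping). [cite: Faltings1983Endlichkeit, §5 Satz 4 (proof, first paragraph)] -/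
theorem mem_rationalEndSpan_of_equivariant (h4 : mem_span_range_tateEndRingHom_iff W ℓ)
    [NumberField K] [W.IsElliptic] {G : Module.End ℚ_[ℓ] (W.rationalTateModule ℓ)}
    (hG : ∀ (σ : Field.absoluteGaloisGroup K) (v : W.rationalTateModule ℓ),
      G (rationalGaloisRepTate W ℓ σ v) = rationalGaloisRepTate W ℓ σ (G v)) :
    G ∈ rationalEndSpan W ℓ := by
  haveI : Module.Free ℤ_[ℓ] (W.tateModule ℓ) := module_free_tateModule_holds W ℓ
  haveI : Module.Finite ℤ_[ℓ] (W.tateModule ℓ) := module_finite_tateModule_holds W ℓ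
  obtain ⟨b, hb, g, hbG⟩ := exists_smul_eq_baseChange ℓ (M := W.tateModule ℓ) G
  have hGc : ∀ σ : Field.absoluteGaloisGroup K,
      G ∘ₗ (galoisRepTate W ℓ σ).baseChange ℚ_[ℓ] = (galoisRepTate W ℓ σ).baseChange ℚ_[ℓ] ∘ₗ G :=
    fun σ ↦ LinearMap.ext fun v ↦ hG σ v
  have hg : ∀ (σ : Field.absoluteGaloisGroup K) (x : W.tateModule ℓ), g (σ • x) = σ • g x := by
    intro σ
    have key : g ∘ₗ galoisRepTate W ℓ σ = galoisRepTate W ℓ σ ∘ₗ g := by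
      apply LinearMap.baseChangeHom_injective ℤ_[ℓ] (W.tateModule ℓ) ℚ_[ℓ]
      simp only [LinearMap.baseChangeHom_apply, LinearMap.baseChange_comp]
      rw [← hbG, LinearMap.smul_comp, LinearMap.comp_smul]
      exact congrArg ((b : ℚ_[ℓ]) • ·) (hGc σ)
    intro x
    exact LinearMap.congr_fun key x
  have hmem : (g.baseChange ℚ_[ℓ] : Module.End ℚ_[ℓ] (W.rationalTateModule ℓ)) ∈
      rationalEndSpan W ℓ := baseChange_mem_rationalEndSpan W ℓ ((h4 g).mpr hg)
  rw [← hbG] at hmem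
  have hb' : (b : ℚ_[ℓ]) ≠ 0 := PadicInt.coe_ne_zero.mpr hb
  exact (Submodule.smul_mem_iff _ hb').mp hmem

/-- **`E_ℓ = End_{Γ_K}(V_ℓ E)`** granted Satz 4 for `E` (the named fact
`mem_span_range_tateEndRingHom_iff W ℓ`): an endomorphism of `V_ℓ E` lies in
`E_ℓ = image(End_K(E) ⊗ ℚ_ℓ)` iff it commutes with `Γ_K` (the easy direction is
`apply_rationalGaloisRepTate_of_mem_rationalEndSpan`). Faltings, §5: `End_K(A) ⊗ ℚ_ℓ → End_π(T_ℓ ⊗ ℚ_ℓ)`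
is bijective. [cite: Faltings1983Endlichkeit, §5 Satz 4] -/
theorem mem_rationalEndSpan_iff (h4 : mem_span_range_tateEndRingHom_iff W ℓ)
    [NumberField K] [W.IsElliptic] (G : Module.End ℚ_[ℓ] (W.rationalTateModule ℓ)) :
    G ∈ rationalEndSpan W ℓ ↔ ∀ (σ : Field.absoluteGaloisGroup K) (v : W.rationalTateModule ℓ),
      G (rationalGaloisRepTate W ℓ σ v) = rationalGaloisRepTate W ℓ σ (G v) :=
  ⟨fun hG σ v ↦ apply_rationalGaloisRepTate_of_mem_rationalEndSpan W ℓ hG σ v,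
    fun hG ↦ mem_rationalEndSpan_of_equivariant W ℓ h4 hG⟩

/-! ## Sätze 3–4 for `E` imply the subspace statement for `E × E` -/

/-- **The subspace statement for `E × E` from Sätze 3–4 for `E`.** For a Weierstrass curve `W`
over `K` and a prime `ℓ`, the named facts `isSemisimpleRepresentation_rationalGaloisRepTate W ℓ`
(Faltings 1983, Satz 3 for `E`: `V_ℓ E` is a semisimple `Γ_K`-module) and
`mem_span_range_tateEndRingHom_iff W ℓ` (Satz 4 for `E`: `ℤ_ℓ · End_K(E) = End_{Γ_K}(T_ℓ E)`)
imply the named fact `stable_subspace_prod_eq_range W ℓ` (for `E` elliptic over the number field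
`K`, every `Γ_K`-stable `ℚ_ℓ`-subspace `U ⊆ V_ℓ E × V_ℓ E` is the image of `(a b; c d)` with
`a b c d ∈ E_ℓ`): `V_ℓ E × V_ℓ E` is semisimple (`Literature.AlgebraicGeometry.Motives.isSemisimpleRepresentation_prod`), so `U` is
the image of a `Γ_K`-equivariant projector `P` (`Literature.AlgebraicGeometry.Motives.exists_equivariant_range_eq`); the entries
`a = pr₁ ∘ P ∘ ι₁`, `b = pr₁ ∘ P ∘ ι₂`, `c = pr₂ ∘ P ∘ ι₁`, `d = pr₂ ∘ P ∘ ι₂` commute with `Γ_K`,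
hence lie in `E_ℓ` (`mem_rationalEndSpan_of_equivariant`), and `P = (a b; c d)`. Together with
`mem_span_range_tateEndRingHom_iff_of_facts` (the converse deduction, granted the elementary
named facts `geomEndRing_comm` and `Isogeny.exists_eq_comp_nsmul_of_geomTorsion_le_ker`) this
shows that `stable_subspace_prod_eq_range W ℓ` is a reformulation of Sätze 3–4 for `E`, as
asserted in the docstring of `FaltingsECSubspaces`. Faltings, Invent. Math. 73 (1983), §5,
Sätze 3–4 and Korollar 1 (for `E, E`), with the step "`W` is the image of an idempotent in
`End_K(A) ⊗ ℚ_ℓ`" of their proof. [cite: Faltings1983Endlichkeit, §5, Sätze 3–4 and Korollar 1] -/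
theorem stable_subspace_prod_eq_range_of_faltings
    (h3 : isSemisimpleRepresentation_rationalGaloisRepTate W ℓ)
    (h4 : mem_span_range_tateEndRingHom_iff W ℓ) : stable_subspace_prod_eq_range W ℓ := by
  intro _ _ U hU
  set ρ := rationalGaloisRepTate W ℓ with hρ
  have hss : (ρ.prod ρ).IsSemisimpleRepresentation := isSemisimpleRepresentation_prod h3 h3
  obtain ⟨P, hP, hPU⟩ := exists_equivariant_range_eq hss U (fun σ v hv ↦ hU σ v hv)
  let a : Module.End ℚ_[ℓ] (W.rationalTateModule ℓ) :=
    LinearMap.fst _ _ _ ∘ₗ P ∘ₗ LinearMap.inl _ _ _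
  let b : Module.End ℚ_[ℓ] (W.rationalTateModule ℓ) :=
    LinearMap.fst _ _ _ ∘ₗ P ∘ₗ LinearMap.inr _ _ _
  let c : Module.End ℚ_[ℓ] (W.rationalTateModule ℓ) :=
    LinearMap.snd _ _ _ ∘ₗ P ∘ₗ LinearMap.inl _ _ _
  let d : Module.End ℚ_[ℓ] (W.rationalTateModule ℓ) :=
    LinearMap.snd _ _ _ ∘ₗ P ∘ₗ LinearMap.inr _ _ _
  have hPe : P = (a.coprod b).prod (c.coprod d) := by
    apply LinearMap.ext
    rintro ⟨x, y⟩
    have hxy : (x, y) = LinearMap.inl ℚ_[ℓ] _ _ x + LinearMap.inr ℚ_[ℓ] _ _ y := by simp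
    rw [hxy, map_add]
    ext <;> simp [a, b, c, d]
  have h1 : ∀ (σ : Field.absoluteGaloisGroup K) (x : W.rationalTateModule ℓ),
      (ρ.prod ρ) σ (x, 0) = (ρ σ x, 0) := fun σ x ↦ by simp [Representation.prod]
  have h2 : ∀ (σ : Field.absoluteGaloisGroup K) (y : W.rationalTateModule ℓ),
      (ρ.prod ρ) σ (0, y) = (0, ρ σ y) := fun σ y ↦ by simp [Representation.prod]
  have hfst : ∀ (σ : Field.absoluteGaloisGroup K) (v : W.rationalTateModule ℓ × W.rationalTateModule ℓ),
      ((ρ.prod ρ) σ v).1 = ρ σ v.1 := fun σ v ↦ by simp [Representation.prod]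
  have hsnd : ∀ (σ : Field.absoluteGaloisGroup K) (v : W.rationalTateModule ℓ × W.rationalTateModule ℓ),
      ((ρ.prod ρ) σ v).2 = ρ σ v.2 := fun σ v ↦ by simp [Representation.prod]
  have ha : a ∈ rationalEndSpan W ℓ := by
    refine mem_rationalEndSpan_of_equivariant W ℓ h4 fun σ x ↦ ?_
    change (P (ρ σ x, 0)).1 = ρ σ (P (x, 0)).1
    rw [← h1, hP, hfst]
  have hb : b ∈ rationalEndSpan W ℓ := by
    refine mem_rationalEndSpan_of_equivariant W ℓ h4 fun σ y ↦ ?_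
    change (P (0, ρ σ y)).1 = ρ σ (P (0, y)).1
    rw [← h2, hP, hfst]
  have hc : c ∈ rationalEndSpan W ℓ := by
    refine mem_rationalEndSpan_of_equivariant W ℓ h4 fun σ x ↦ ?_
    change (P (ρ σ x, 0)).2 = ρ σ (P (x, 0)).2
    rw [← h1, hP, hsnd]
  have hd : d ∈ rationalEndSpan W ℓ := by
    refine mem_rationalEndSpan_of_equivariant W ℓ h4 fun σ y ↦ ?_
    change (P (0, ρ σ y)).2 = ρ σ (P (0, y)).2
    rw [← h2, hP, hsnd]
  exact ⟨a, b, c, d, ha, hb, hc, hd, by rw [← hPe, hPU]⟩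

end Literature.AlgebraicGeometry.Motives
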